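import Mathlib
import HarnessLib
import Summits.HubbardSuperconductivity.HubbardSuperconductivity.Theorems.KLProgrammeKLRegimeSplitPredicatesV2

/-!
# Route `KLProgramme` — the row-0′ majorant is `O(U²)` uniformly in the scale (packaging arithmetic for (B1-v2)'s `C_W·U²`)

Cell gate-hubbard-kl, seat p3.  `pairLadder_envelope` / `pairArray_envelope` bound the pair arrays by the closed-form majorant
`A_n = initDevBar G U + 2·Σ_{j<n}(drivePBar G P U j + ē_j)` (plus `(Klam U)²·3CF + Σ_{j<n} ē_j` for the frozen part).  Here:
**`eremBar_sum_le`** (`Σ_{j<n} ē_j ≤ (cloc·Klam²·(1 - 4^{-θ})⁻¹ + 2·CR·Klam³·|U|)·U² + Σ_{j<n} CL β j / L` — geometric sums, `G.WF`'s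
`θ > 0`), **`drivePBar_sum_le`** (`Σ_{j<n} drivePBar ≤ aplus·Klam²·Z·U²`, `G.WF`'s `Σ ζ ≤ Z`), and **`rowZero_majorant_le`**: `A_n ≤ c(G,P,Q,U)·U² +
2·Σ_{j<n} CL β j / L` with `c = (Σ_χ(abot χ + atop χ) + 1) + 2·(aplus Klam² Z + cloc Klam² (1 - 4^{-θ})⁻¹ + 2 CR Klam³ |U|)` — so (B1-v2)'s
`P.C_W` can be taken `G,P`-dependent once `U ≤ U₀(Q)` absorbs `CR Klam³ |U|` and child 1's volume threshold absorbs `Σ CL/L`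
(child 1 = `∀ G ∃ P ∀ Q … ∃ U₀ ∃ L₁`).  Everything is proved; no definitions.
-/

noncomputable section

namespace Summit.HubbardSuperconductivity.HubbardSuperconductivity.Theorems.KLRegimeSplit

set_option linter.dupNamespace false -- summit = problem name (single-conjunct summit), D-0017

open Finset Literature.MathematicalPhysics.QuantumLattice Literature.Probability.LatticeModels
open Summit.HubbardSuperconductivity.HubbardSuperconductivity.Theorems.KLProgrammeLegKernels
open Summit.HubbardSuperconductivity.HubbardSuperconductivity.Theorems.CooperChannelRiccatiFlow

variable {G : GeoConsts} {P : SplitConsts} {Qc : EngConsts}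

/-- Geometric sum of the localisation slack: `Σ_{j<n} 4^{-θ j} ≤ (1 - 4^{-θ})⁻¹` for `θ > 0`. -/
theorem sum_four_rpow_neg_le {θ : ℝ} (hθ : 0 < θ) (n : ℕ) :
    ∑ j ∈ range n, (4 : ℝ) ^ (-(θ * j)) ≤ (1 - (4 : ℝ) ^ (-θ))⁻¹ := by
  have hr0 : 0 ≤ (4 : ℝ) ^ (-θ) := Real.rpow_nonneg (by norm_num) _
  have hr1 : (4 : ℝ) ^ (-θ) < 1 := Real.rpow_lt_one_of_one_lt_of_neg (by norm_num) (by linarith)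
  have heq : ∀ j : ℕ, (4 : ℝ) ^ (-(θ * j)) = ((4 : ℝ) ^ (-θ)) ^ j := fun j => by
    rw [show -(θ * j) = (-θ) * (j : ℝ) by ring, Real.rpow_mul (by norm_num), Real.rpow_natCast]
  simp_rw [heq]
  calc ∑ j ∈ range n, ((4 : ℝ) ^ (-θ)) ^ j ≤ ∑' j, ((4 : ℝ) ^ (-θ)) ^ j :=
        (summable_geometric_of_lt_one hr0 hr1).sum_le_tsum _ (fun j _ => pow_nonneg hr0 j)
    _ = (1 - (4 : ℝ) ^ (-θ))⁻¹ := by rw [tsum_geometric_of_lt_one hr0 hr1]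

/-- `Σ_{j<n} (2^j)⁻¹ ≤ 2`. -/
theorem sum_two_pow_inv_le (n : ℕ) : ∑ j ∈ range n, ((2 : ℝ) ^ j)⁻¹ ≤ 2 := by
  have h := sum_geometric_two_le n
  have : ∀ j : ℕ, ((2 : ℝ) ^ j)⁻¹ = ((1 : ℝ) / 2) ^ j := fun j => by rw [one_div, inv_pow]
  simp_rw [this]
  exact h

/-- **The remainders sum to `O(U²)` plus the finite-volume term**:
`Σ_{j<n} ē_j ≤ (cloc·Klam²·(1 - 4^{-θ})⁻¹ + 2·CR·Klam³·|U|)·U² + Σ_{j<n} CL β j / L`. -/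
theorem eremBar_sum_le (hG : G.WF) (hP : P.WF) (hQc : Qc.WF) (U β : ℝ) (L n : ℕ) :
    ∑ j ∈ range n, eremBar G P Qc U β L j ≤
      (G.cloc * P.Klam ^ 2 * (1 - (4 : ℝ) ^ (-G.θ))⁻¹ + 2 * Qc.CR * P.Klam ^ 3 * |U|) * U ^ 2 +
        ∑ j ∈ range n, Qc.CL β j / L := by
  obtain ⟨-, -, -, -, hcloc, hθ, -⟩ := hG
  have hK0 : 0 ≤ P.Klam := zero_le_one.trans hP.1
  have hCR : 0 ≤ Qc.CR := hQc.2.1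
  simp only [eremBar, sum_add_distrib]
  have h1 : ∑ j ∈ range n, G.cloc * (P.Klam * U) ^ 2 * (4 : ℝ) ^ (-(G.θ * j)) ≤
      G.cloc * P.Klam ^ 2 * (1 - (4 : ℝ) ^ (-G.θ))⁻¹ * U ^ 2 := by
    rw [← mul_sum]
    have := sum_four_rpow_neg_le hθ n
    have hc : 0 ≤ G.cloc * (P.Klam * U) ^ 2 := mul_nonneg hcloc (sq_nonneg _)
    calc G.cloc * (P.Klam * U) ^ 2 * ∑ j ∈ range n, (4 : ℝ) ^ (-(G.θ * j))
        ≤ G.cloc * (P.Klam * U) ^ 2 * (1 - (4 : ℝ) ^ (-G.θ))⁻¹ := mul_le_mul_of_nonneg_left this hc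
      _ = G.cloc * P.Klam ^ 2 * (1 - (4 : ℝ) ^ (-G.θ))⁻¹ * U ^ 2 := by ring
  have h2 : ∑ j ∈ range n, Qc.CR * (P.Klam * |U|) ^ 3 * ((2 : ℝ) ^ j)⁻¹ ≤ 2 * Qc.CR * P.Klam ^ 3 * |U| * U ^ 2 := by
    rw [← mul_sum]
    have := sum_two_pow_inv_le n
    have hc : 0 ≤ Qc.CR * (P.Klam * |U|) ^ 3 := mul_nonneg hCR (pow_nonneg (mul_nonneg hK0 (abs_nonneg U)) 3)
    have habs : |U| ^ 3 = |U| * U ^ 2 := by rw [pow_succ, pow_two, ← sq_abs]; ring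
    calc Qc.CR * (P.Klam * |U|) ^ 3 * ∑ j ∈ range n, ((2 : ℝ) ^ j)⁻¹ ≤ Qc.CR * (P.Klam * |U|) ^ 3 * 2 :=
          mul_le_mul_of_nonneg_left this hc
      _ = 2 * Qc.CR * P.Klam ^ 3 * |U| * U ^ 2 := by rw [mul_pow, habs]; ring
  nlinarith [h1, h2]

/-- **The repulsive drive sums to `O(U²)`**: `Σ_{j<n} drivePBar ≤ aplus·Klam²·Z·U²`. -/
theorem drivePBar_sum_le (hG : G.WF) (U : ℝ) (n : ℕ) :
    ∑ j ∈ range n, drivePBar G P U j ≤ G.aplus * P.Klam ^ 2 * G.Z * U ^ 2 := by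
  obtain ⟨-, -, -, -, -, -, -, -, -, hZ, haplus, -⟩ := hG
  simp only [drivePBar]
  rw [← mul_sum]
  calc G.aplus * (P.Klam * U) ^ 2 * ∑ j ∈ range n, G.ζ j ≤ G.aplus * (P.Klam * U) ^ 2 * G.Z :=
        mul_le_mul_of_nonneg_left (hZ n) (mul_nonneg haplus (sq_nonneg _))
    _ = G.aplus * P.Klam ^ 2 * G.Z * U ^ 2 := by ring

/-- **The row-0′ majorant is `O(U²)`**: `A_n ≤ c·U² + 2·Σ_{j<n} CL β j / L`,
`c = (Σ_χ(abot χ + atop χ) + 1) + 2·(aplus Klam² Z + cloc Klam² (1 - 4^{-θ})⁻¹ + 2 CR Klam³ |U|)`. -/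
theorem rowZero_majorant_le (hG : G.WF) (hP : P.WF) (hQc : Qc.WF) (U β : ℝ) (L n : ℕ) :
    initDevBar G U + 2 * ∑ j ∈ range n, (drivePBar G P U j + eremBar G P Qc U β L j) ≤
      ((∑ χ : D4Irrep, (G.abot χ + G.atop χ) + 1) +
          2 * (G.aplus * P.Klam ^ 2 * G.Z + G.cloc * P.Klam ^ 2 * (1 - (4 : ℝ) ^ (-G.θ))⁻¹ + 2 * Qc.CR * P.Klam ^ 3 * |U|)) *
        U ^ 2 + 2 * ∑ j ∈ range n, Qc.CL β j / L := by
  have h1 := drivePBar_sum_le (P := P) hG U n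
  have h2 := eremBar_sum_le hG hP hQc U β L n
  rw [sum_add_distrib]
  unfold initDevBar
  nlinarith [h1, h2, sq_nonneg U]

end Summit.HubbardSuperconductivity.HubbardSuperconductivity.Theorems.KLRegimeSplit

end
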